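import Mathlib
import Literature.NumberTheory.GaloisRepresentations.SerreProp16PGL2Cor

/-!
# Route `DedekindQuotient1951` (Langlands) — support `DoudMoorePermutationSupply`: `A₅` and its
standard representation

Finite group theory and linear algebra for the irreducibility of the `4`-dimensional constituent of
the permutation representation of the Doud–Moore quintic:

* `alternatingGroup_le_of_orderOf` — a subgroup of `S₅` containing an element of order `5` and an
  element of order `3` contains `A₅` (its even part has order divisible by `15`, hence index `≤ 4`
  in the simple group `A₅`, so it is `A₅`: a proper subgroup of index `n ≤ 4` would embed `A₅`
  into `Sₙ`);
* `exists_mem_alternatingGroup_apply_eq` — `A₅` is doubly transitive;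
* `exists_pow_apply_eq_of_orderOf_eq_five` — an element of order `5` of `S₅` is transitive;
* `eq_bot_or_forall_mem_of_alternating_stable` — over a field of characteristic `0`, a subspace of
  the sum-zero hyperplane `V₀ ⊆ A⁵` stable under the coordinate action of `A₅` is `0` or `V₀`
  (the standard `4`-dimensional representation of `A₅` is irreducible).

References: J.-P. Serre, *Linear representations of finite groups*, GTM 42, §2.3 (Ex. 2.6);
B. Huppert, *Endliche Gruppen I*, II.8 (subgroups of `A₅`); folklore.
-/

set_option linter.dupNamespace false

noncomputable section

open Equiv Equiv.Perm

namespace Summit.Langlands.Langlands.Theorems.DedekindQuotient1951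

/-! ### Subgroups of `S₅` containing elements of order `3` and `5` -/

/-- A permutation of odd order is even. [folklore] -/
theorem sign_eq_one_of_odd_orderOf {α : Type*} [Fintype α] [DecidableEq α] {g : Perm α}
    (h : Odd (orderOf g)) : sign g = 1 := by
  have h1 := congrArg sign (pow_orderOf_eq_one g)
  obtain ⟨k, hk⟩ := h
  rw [map_pow, map_one, hk, pow_succ, pow_mul, Int.units_sq, one_pow, one_mul] at h1
  exact h1

/-- **A subgroup of `S₅` containing an element of order `5` and an element of order `3` contains
`A₅`.**  Proof: both elements are even; the even part `H'` of the subgroup has order divisible by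
`15`, so index `1`, `2` or `4` in `A₅`; if the index were `2` or `4`, the normal core of `H'` would be
a normal subgroup of the simple group `A₅`, either `⊤` (impossible) or `⊥`, in which case `A₅` would
embed in the symmetric group on `A₅ / H'`, of order `2` or `24 < 60`. [folklore] -/
theorem alternatingGroup_le_of_orderOf {H : Subgroup (Perm (Fin 5))} {g h : Perm (Fin 5)}
    (hg : g ∈ H) (hh : h ∈ H) (hg5 : orderOf g = 5) (hh3 : orderOf h = 3) :
    alternatingGroup (Fin 5) ≤ H := by
  have hgA : g ∈ alternatingGroup (Fin 5) :=
    mem_alternatingGroup.mpr (sign_eq_one_of_odd_orderOf (by rw [hg5]; decide))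
  have hhA : h ∈ alternatingGroup (Fin 5) :=
    mem_alternatingGroup.mpr (sign_eq_one_of_odd_orderOf (by rw [hh3]; decide))
  set H' : Subgroup (alternatingGroup (Fin 5)) := H.subgroupOf (alternatingGroup (Fin 5)) with hH'
  have hA := Literature.NumberTheory.GaloisRepresentations.Serre1972.natCard_alternatingGroup_fin_five
  -- `15 ∣ |H'|`
  have h15 : 15 ∣ Nat.card H' := by
    let g' : H' := ⟨⟨g, hgA⟩, Subgroup.mem_subgroupOf.mpr hg⟩
    let h' : H' := ⟨⟨h, hhA⟩, Subgroup.mem_subgroupOf.mpr hh⟩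
    have hg' : orderOf g' = 5 := by
      rw [← Subgroup.orderOf_coe, ← Subgroup.orderOf_coe]; exact hg5
    have hh' : orderOf h' = 3 := by
      rw [← Subgroup.orderOf_coe, ← Subgroup.orderOf_coe]; exact hh3
    have h5 : 5 ∣ Nat.card H' := by have := orderOf_dvd_natCard g'; rwa [hg'] at this
    have h3 : 3 ∣ Nat.card H' := by have := orderOf_dvd_natCard h'; rwa [hh'] at this
    exact Nat.Coprime.mul_dvd_of_dvd_of_dvd (by norm_num) h3 h5
  -- the index of `H'` divides `4`
  have hidx : H'.index * Nat.card H' = 60 := by rw [H'.index_mul_card, hA]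
  obtain ⟨m, hm⟩ := h15
  have him : H'.index * m = 4 := by
    apply Nat.eq_of_mul_eq_mul_left (show 0 < 15 by norm_num)
    rw [← mul_assoc, mul_comm 15, mul_assoc, ← hm, hidx]
  have hdvd : H'.index ∣ 4 := Dvd.intro m him
  have hle : H'.index ≤ 4 := Nat.le_of_dvd (by norm_num) hdvd
  -- `H' = ⊤`
  have htop : H' = ⊤ := by
    by_contra hne
    have hne1 : H'.index ≠ 1 := fun h1 => hne (Subgroup.index_eq_one.mp h1)
    haveI : IsSimpleGroup (alternatingGroup (Fin 5)) :=
      alternatingGroup.isSimpleGroup (by rw [Nat.card_eq_fintype_card, Fintype.card_fin])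
    rcases (inferInstance : H'.normalCore.Normal).eq_bot_or_eq_top with hb | ht
    · -- `A₅ ↪ Sym(A₅ / H')`, of order `index! ∈ {2, 24}`
      have hinj : Function.Injective
          (MulAction.toPermHom (alternatingGroup (Fin 5)) (alternatingGroup (Fin 5) ⧸ H')) := by
        rw [← MonoidHom.ker_eq_bot_iff, ← Subgroup.normalCore_eq_ker]
        exact hb
      have hd := Subgroup.card_dvd_of_injective _ hinj
      rw [hA, Nat.card_perm] at hd
      change 60 ∣ Nat.factorial H'.index at hd
      interval_cases H'.index
      · exact absurd hdvd (by decide)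
      · exact hne1 rfl
      · exact absurd hd (by decide)
      · exact absurd hdvd (by decide)
      · exact absurd hd (by decide)
    · exact hne (top_le_iff.mp (ht ▸ Subgroup.normalCore_le H'))
  -- conclusion
  intro x hx
  have hx' : (⟨x, hx⟩ : alternatingGroup (Fin 5)) ∈ H' := htop ▸ Subgroup.mem_top _
  exact Subgroup.mem_subgroupOf.mp hx'

/-! ### Transitivity -/

/-- **`A₅` is doubly transitive**: any ordered pair of distinct points is carried to any other by an
even permutation. [folklore] -/
theorem exists_mem_alternatingGroup_apply_eq (a b a' b' : Fin 5) (hab : a ≠ b) (hab' : a' ≠ b') :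
    ∃ p ∈ alternatingGroup (Fin 5), p a = a' ∧ p b = b' := by
  classical
  -- `p₀ = (q a, a') ∘ q`, `q = (b, b')`, maps `a ↦ a'`, `b ↦ b'`
  set q : Perm (Fin 5) := swap b b' with hq
  have hqa : q a ≠ b' := by
    rw [hq, swap_apply_def]
    split_ifs with h1 h2
    · exact absurd h1 hab
    · exact fun h => hab (h2.trans h.symm) |>.elim
    · exact h2
  set p₀ : Perm (Fin 5) := swap (q a) a' * q with hp₀
  have hp₀a : p₀ a = a' := by rw [hp₀, Perm.mul_apply, swap_apply_left]
  have hp₀b : p₀ b = b' := by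
    rw [hp₀, Perm.mul_apply, hq, swap_apply_left, swap_apply_of_ne_of_ne hqa.symm hab'.symm]
  by_cases hs : sign p₀ = 1
  · exact ⟨p₀, mem_alternatingGroup.mpr hs, hp₀a, hp₀b⟩
  · -- fix the parity with a transposition of two points off `{a, b}`
    have hcard : 1 < ((Finset.univ.erase a).erase b).card := by
      rw [Finset.card_erase_of_mem (Finset.mem_erase.mpr ⟨hab.symm, Finset.mem_univ b⟩),
        Finset.card_erase_of_mem (Finset.mem_univ a), Finset.card_univ, Fintype.card_fin]
      norm_num
    obtain ⟨u, hu, v, hv, huv⟩ := Finset.one_lt_card.mp hcard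
    simp only [Finset.mem_erase, Finset.mem_univ, and_true] at hu hv
    refine ⟨p₀ * swap u v, mem_alternatingGroup.mpr ?_, ?_, ?_⟩
    · rw [map_mul, sign_swap huv]
      rcases Int.units_eq_one_or (sign p₀) with h1 | h1
      · exact absurd h1 hs
      · rw [h1]; decide
    · rw [Perm.mul_apply, swap_apply_of_ne_of_ne (Ne.symm hu.2) (Ne.symm hv.2), hp₀a]
    · rw [Perm.mul_apply, swap_apply_of_ne_of_ne (Ne.symm hu.1) (Ne.symm hv.1), hp₀b]

/-- **An element of order `5` of `S₅` acts transitively** (it is a `5`-cycle). [folklore] -/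
theorem exists_pow_apply_eq_of_orderOf_eq_five {g : Perm (Fin 5)} (hg : orderOf g = 5)
    (i j : Fin 5) : ∃ k : ℕ, (g ^ k) i = j := by
  have key : ∀ g : Perm (Fin 5), g ^ 5 = 1 → g ≠ 1 → ∀ i j : Fin 5, ∃ k : Fin 5, (g ^ (k : ℕ)) i = j := by
    set_option maxRecDepth 100000 in
    decide
  have hg1 : g ≠ 1 := by
    rintro rfl
    rw [orderOf_one] at hg
    exact absurd hg (by norm_num)
  obtain ⟨k, hk⟩ := key g (by have := pow_orderOf_eq_one g; rwa [hg] at this) hg1 i j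
  exact ⟨k, hk⟩

/-! ### The standard representation of `A₅` is irreducible -/

section Irreducible

variable {A : Type*}

/-- The coordinate action `x ↦ x ∘ p⁻¹` of a permutation `p` on `A⁵` sends `eⱼ` to `e_{p j}`.
[folklore] -/
theorem comp_perm_inv_single [Zero A] [One A] (p : Perm (Fin 5)) (j : Fin 5) :
    (fun i => (Pi.single j (1 : A) : Fin 5 → A) (p⁻¹ i)) = Pi.single (p j) 1 := by
  funext i
  rw [Pi.single_apply, Pi.single_apply]
  congr 1
  exact propext Perm.inv_eq_iff_eq

variable [Field A] [CharZero A]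

/-- **The standard representation of `A₅` is irreducible** (characteristic `0`).  A subspace `W` of
the sum-zero hyperplane `V₀ ⊆ A⁵` stable under the coordinate action of `A₅` is `0` or all of `V₀`:
if `0 ≠ w ∈ W` then two coordinates of `w` differ, by double transitivity `w 0 ≠ w 1`; with
`t = (0 1)(2 3)`, `r = (2 3 4)` and `u = t ⋆ w - w` one has `u + r ⋆ u + r² ⋆ u = 3 (w 1 - w 0) (e₀ - e₁)`,
so `e₀ - e₁ ∈ W`, hence every `e_a - e_b ∈ W` and `W = V₀`. [folklore] -/
theorem eq_bot_or_forall_mem_of_alternating_stable (W : Submodule A (Fin 5 → A))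
    (hW₀ : ∀ x ∈ W, ∑ i, x i = 0)
    (hW : ∀ p ∈ alternatingGroup (Fin 5), ∀ x ∈ W, (fun i => x (p⁻¹ i)) ∈ W) :
    W = ⊥ ∨ ∀ x : Fin 5 → A, ∑ i, x i = 0 → x ∈ W := by
  by_cases hbot : W = ⊥
  · exact Or.inl hbot
  right
  obtain ⟨w, hwW, hw0⟩ := (Submodule.ne_bot_iff W).mp hbot
  -- two coordinates of `w` differ
  obtain ⟨a, b, habw⟩ : ∃ a b, w a ≠ w b := by
    by_contra hall
    push Not at hall
    apply hw0
    have hsum := hW₀ w hwW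
    have hc : ∀ i, w i = w 0 := fun i => hall i 0
    simp only [hc, Finset.sum_const, Finset.card_univ, Fintype.card_fin, nsmul_eq_mul,
      Nat.cast_ofNat, mul_eq_zero, OfNat.ofNat_ne_zero, false_or] at hsum
    funext i
    rw [hc i, hsum, Pi.zero_apply]
  have hab : a ≠ b := fun h => habw (h ▸ rfl)
  -- move them to the coordinates `0, 1`
  obtain ⟨p, hpA, hpa, hpb⟩ := exists_mem_alternatingGroup_apply_eq a b 0 1 hab (by decide)
  set w' : Fin 5 → A := fun i => w (p⁻¹ i) with hw'
  have hw'W : w' ∈ W := hW p hpA w hwW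
  have h01 : w' 0 ≠ w' 1 := by
    simp only [hw', ← hpa, ← hpb]
    erw [Equiv.symm_apply_apply, Equiv.symm_apply_apply]
    exact habw
  -- the elements `t = (0 1)(2 3)` and `r = (2 3 4)` of `A₅`
  set t : Perm (Fin 5) := swap 0 1 * swap 2 3 with ht
  set r : Perm (Fin 5) := swap 2 4 * swap 2 3 with hr
  have htA : t ∈ alternatingGroup (Fin 5) := by rw [mem_alternatingGroup, ht]; decide
  have hrA : r ∈ alternatingGroup (Fin 5) := by rw [mem_alternatingGroup, hr]; decide
  set u : Fin 5 → A := (fun i => w' (t⁻¹ i)) - w' with hu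
  have huW : u ∈ W := W.sub_mem (hW t htA w' hw'W) hw'W
  set u₁ : Fin 5 → A := fun i => u (r⁻¹ i) with hu₁
  have hu₁W : u₁ ∈ W := hW r hrA u huW
  set u₂ : Fin 5 → A := fun i => u₁ (r⁻¹ i) with hu₂
  have hu₂W : u₂ ∈ W := hW r hrA u₁ hu₁W
  set s := u + u₁ + u₂ with hs
  have hsW : s ∈ W := W.add_mem (W.add_mem huW hu₁W) hu₂W
  -- `s = 3 (w' 1 - w' 0) • (e₀ - e₁)`
  have hs' : s = (3 * (w' 1 - w' 0)) • (Pi.single 0 (1 : A) - Pi.single 1 1) := by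
    funext i
    simp only [hs, hu, hu₁, hu₂, ht, hr, Pi.add_apply, Pi.sub_apply, Pi.smul_apply,
      smul_eq_mul, mul_inv_rev, swap_inv, Perm.mul_apply]
    fin_cases i <;> simp [swap_apply_def, Fin.ext_iff] <;> ring
  -- `e₀ - e₁ ∈ W`
  have h3 : (3 * (w' 1 - w' 0) : A) ≠ 0 :=
    mul_ne_zero three_ne_zero (sub_ne_zero.mpr h01.symm)
  have he01 : (Pi.single 0 (1 : A) - Pi.single 1 1) ∈ W := by
    have := W.smul_mem (3 * (w' 1 - w' 0))⁻¹ hsW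
    rwa [hs', smul_smul, inv_mul_cancel₀ h3, one_smul] at this
  -- every `e_a - e_b ∈ W`
  have hdiff : ∀ c d : Fin 5, (Pi.single c (1 : A) - Pi.single d 1) ∈ W := by
    intro c d
    by_cases hcd : c = d
    · rw [hcd, sub_self]; exact W.zero_mem
    obtain ⟨p', hp'A, hp'0, hp'1⟩ := exists_mem_alternatingGroup_apply_eq 0 1 c d (by decide) hcd
    have := hW p' hp'A _ he01
    have heq : (fun i => (Pi.single 0 (1 : A) - Pi.single 1 1 : Fin 5 → A) (p'⁻¹ i)) =
        Pi.single c (1 : A) - Pi.single d 1 := by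
      rw [← hp'0, ← hp'1, ← comp_perm_inv_single p' 0, ← comp_perm_inv_single p' 1]
      rfl
    rwa [heq] at this
  -- conclusion: `x = ∑ᵢ xᵢ (eᵢ - e₀)` for `x ∈ V₀`
  intro x hx
  have hxe : x = ∑ i, x i • (Pi.single i (1 : A) - Pi.single 0 1) := by
    simp only [smul_sub, Finset.sum_sub_distrib, ← Finset.sum_smul, hx, zero_smul, sub_zero]
    funext j
    simp [Finset.sum_apply, Pi.single_apply]
  rw [hxe]
  exact W.sum_mem fun i _ => W.smul_mem _ (hdiff i 0)

end Irreducible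

end Summit.Langlands.Langlands.Theorems.DedekindQuotient1951

end
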